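import Mathlib
import Literature.Computability.Complexity.ExtMonotoneGates
import Literature.Computability.Complexity.CliqueApproximatorsWide
import Literature.Computability.Complexity.RossmanMonotoneCliqueProb

/-!
# Route ConvexRankGates, crux `LinAlgGateBlind` (stmt-PneNP-10681), line `dnf-invariant-wide-gates-see-small-cliques`: definitions

Objects posited by the line `dnf-invariant-wide-gates-see-small-cliques` for the crux
`Summit.PneNP.PneNP.Theses.ConvexRankGates.LinAlgGateBlind` (skeleton
`Summits/PneNP/PneNP/Cruxes/LinAlgGateBlind/Lines/dnf-invariant-wide-gates-see-small-cliques.lean`, whose SIX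
registered stubs `stub_termCollapse`, `stub_pluckingBound`, `stub_wideApproxHost`, `stub_denseRegime`,
`stub_sgPerm`, `stub_sgGRank` are stated in exactly this vocabulary and namespace, so that each stub can land as its
own `Theorems/ConvexRankGatesLinAlgGateBlind<Stub>.lean` importing this file).

The line runs the Alon–Boppana approximation method in the lattice `K(m, r, l)` of closed families
(`Razborov.IsClosedFamily`, `Razborov.closure`) on the referee pair POSITIVES = bare `k`-cliques `cliqueVec S`,
NEGATIVES = the product measure `prob q` on the edges of `K_m` (`G(m, q)`), and pushes the invariant "every wire
carries a small-clique DNF `⌈F⌉`" through the wide PERM / GRANK gates of the crux basis. This file fixes: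

* the parameters of the dense regime at `δ = 1/8`: `kOf m = ⌈m^{1/8}⌉₊`, `lOf m = ⌊√(k/(4 log₂ m + 1))⌋₊`,
  `rOf c m = (l + c + 2)(⌊log₂ m⌋ + 1) + 2`, `qOf m = 1 - 4 ln m / k`, `epsOf c m = m^{-(c+1)}/4`;
* the Boolean atoms `atomB X` (`= ⌈X⌉`, all edges inside `X` on) and small-clique DNFs `acceptsB 𝒜` (`= ⌈𝒜⌉`);
* TERM GATES `IsTermGate m P l O`: `O` is ONE gate of class `P` fed with atoms of `≤ l`-vertex sets;
* the ONE-SIDED errors of a candidate DNF `⌈𝒜⌉` for a function `O` on the referee pair: `lostPos` (bare `k`-cliques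
  accepted by `O` but not by `⌈𝒜⌉`) and `gainedNeg` (`Pr_{G(m,q)}[O = 0 ∧ ⌈𝒜⌉ = 1]`);
* the single-gate statement `SGAt` and the per-gate interface `GateApprox` of the host induction.

Definitions only (no facts are asserted); the statements, the stubs and the kernel-checked composition
`LinAlgGateBlind_of` live in the skeleton. Sources: Alon–Boppana 1987 §3 (lattice `K(m,r,l)`), Razborov 1985;
the one-sided error convention is the tree's `errPos`/`errNeg` (`CliqueApproximators.lean`). [folklore]
-/

-- `Summit.PneNP.PneNP.…` duplicates `PneNP` BY DESIGN (single-problem summit).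
set_option linter.dupNamespace false

noncomputable section

namespace Summit.PneNP.PneNP.Cruxes.LinAlgGateBlind.DnfInvariantWideGatesSeeSmallCliques

open scoped BigOperators
open Finset Filter Literature.Computability.Complexity Razborov

/-! ### Parameters of the line (`δ = 1/8`, the Alon–Boppana dense regime) -/

/-- Clique size `k = ⌈m^{1/8}⌉₊` (`δ = 1/8`). [folklore] -/
def kOf (m : ℕ) : ℕ := ⌈(m : ℝ) ^ (1 / 8 : ℝ)⌉₊

/-- Lattice parameter `l = ⌊√(k / (4 log₂ m + 1))⌋₊` (atoms have `≤ l` vertices; chosen so that an atom is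
present in `G(m,q)` with probability `q^{C(l,2)} ≥ 1/2`). [folklore] -/
def lOf (m : ℕ) : ℕ := ⌊Real.sqrt ((kOf m : ℝ) / (4 * Real.logb 2 m + 1))⌋₊

/-- Sunflower parameter `r = (l + c + 2)(⌊log₂ m⌋ + 1) + 2` of `K(m, r, l)`. [folklore] -/
def rOf (c m : ℕ) : ℕ := (lOf m + c + 2) * (Nat.log 2 m + 1) + 2

/-- Edge density `q = 1 - 4 ln m / k` of the negative distribution `G(m, q)` (dense, `k`-clique-free with
high probability). [folklore] -/
def qOf (m : ℕ) : ℝ := 1 - 4 * Real.log m / (kOf m : ℝ)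

/-- Per-gate error budget `ε = m^{-(c+1)} / 4`. [folklore] -/
def epsOf (c m : ℕ) : ℝ := (m : ℝ) ^ (-((c : ℝ) + 1)) / 4

/-- `0 ≤ ε` (registered carrier lemma of this definitions file). [folklore] -/
theorem epsOf_nonneg : ∀ (c m : ℕ), 0 ≤ epsOf c m := fun _ m =>
  div_nonneg (Real.rpow_nonneg (Nat.cast_nonneg m) _) (by norm_num)

/-! ### Small-clique DNFs, atoms, term gates and their one-sided errors on the referee pair -/

open Classical in
/-- The clique ATOM `⌈X⌉` as a Boolean function: all edges inside `X` are on (`CliquePresent`). [folklore] -/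
def atomB {m : ℕ} (X : Finset (Fin m)) (x : KEdge m → Bool) : Bool := decide (CliquePresent X x)

open Classical in
/-- The small-clique DNF `⌈𝒜⌉ = ⋁_{X ∈ 𝒜} ⌈X⌉` as a Boolean function (`Accepts`). [folklore] -/
def acceptsB {m : ℕ} (𝒜 : Finset (Finset (Fin m))) (x : KEdge m → Bool) : Bool := decide (Accepts 𝒜 x)

/-- **Term gates.** `IsTermGate m P l O`: the Boolean function `O` on graphs is ONE gate `g` with `P g`
(e.g. `P = IsPermGate s` or `IsGRankGate s`) whose inputs are clique atoms `⌈X_a⌉` of small vertex sets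
`X_a ∈ 𝒱(l)` (`smallSets`: `#X ≤ l`, `#X ≠ 1`; `X = ∅` is the constant-true atom). [folklore] -/
def IsTermGate (m : ℕ) (P : GateFn → Prop) (l : ℕ) (O : (KEdge m → Bool) → Bool) : Prop :=
  ∃ g : GateFn, P g ∧ ∃ X : Fin g.1 → Finset (Fin m),
    (∀ a, X a ∈ smallSets (Fin m) l) ∧ ∀ x, O x = g.2 (fun a => atomB (X a) x)

open Classical in
/-- **Lost positives** (one-sided): the `k`-sets `S` whose bare clique `cliqueVec S` is accepted by `O` but
not by the small-clique DNF `⌈𝒜⌉` (the convention of the tree's `errPos`). [folklore] -/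
def lostPos (m k : ℕ) (O : (KEdge m → Bool) → Bool) (𝒜 : Finset (Finset (Fin m))) :
    Finset (Finset (Fin m)) :=
  (powersetCard k (univ : Finset (Fin m))).filter fun S =>
    O (cliqueVec S) = true ∧ ¬ Accepts 𝒜 (cliqueVec S)

/-- **Gained negatives** (one-sided): `Pr_{G ∼ G(m,q)}[O(G) = 0 ∧ ⌈𝒜⌉(G) = 1]` (the convention of the
tree's `errNeg`, with the product measure `prob q` in place of colourings). [folklore] -/
def gainedNeg (m : ℕ) (q : ℝ) (O : (KEdge m → Bool) → Bool) (𝒜 : Finset (Finset (Fin m))) : ℝ :=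
  prob q (fun x : KEdge m → Bool => O x = false ∧ Accepts 𝒜 x)

/-- **SG, the single-gate statement of the line (one-sided).** `SGAt m P l k q ε`: every term gate `O` with
gate class `P` over `≤ l`-atoms is `ε`-approximated by SOME small-clique DNF `⌈𝒜⌉`, `𝒜 ⊆ 𝒱(l)`: at most
`ε·C(m,k)` bare `k`-cliques are accepted by `O` but not by `⌈𝒜⌉`, and with probability at most `ε` a graph of
`G(m,q)` is accepted by `⌈𝒜⌉` but rejected by `O`. [folklore] -/
def SGAt (m : ℕ) (P : GateFn → Prop) (l k : ℕ) (q ε : ℝ) : Prop :=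
  ∀ O : (KEdge m → Bool) → Bool, IsTermGate m P l O →
    ∃ 𝒜 ⊆ smallSets (Fin m) l,
      (#(lostPos m k O 𝒜) : ℝ) ≤ ε * (m.choose k : ℝ) ∧ gainedNeg m q O 𝒜 ≤ ε

/-- **Per-gate interface of the host.** `GateApprox m k r l q εP εN g`: the gate `g`, fed with CLOSED
families `A_i ∈ K(m, r, l)` (i.e. with the small-clique DNFs `⌈A_i⌉` of its children), has a closed
approximator `F` losing `≤ εP·C(m,k)` bare `k`-cliques and gaining `≤ εN` of `G(m,q)`, one-sidedly. [folklore] -/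
def GateApprox (m k r l : ℕ) (q εP εN : ℝ) (g : GateFn) : Prop :=
  ∀ A : Fin g.1 → Finset (Finset (Fin m)), (∀ i, IsClosedFamily r l (A i)) →
    ∃ F : Finset (Finset (Fin m)), IsClosedFamily r l F ∧
      (#(lostPos m k (fun x => g.2 fun i => acceptsB (A i) x) F) : ℝ) ≤ εP * (m.choose k : ℝ) ∧
      gainedNeg m q (fun x => g.2 fun i => acceptsB (A i) x) F ≤ εN

end Summit.PneNP.PneNP.Cruxes.LinAlgGateBlind.DnfInvariantWideGatesSeeSmallCliques

end
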